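import Summits.HodgeConjecture.HodgeConjecture.Theorems.F0P6aStubFROBRoofGeoHoles
import HarnessLib

/-!
# `F0P6aStubFROBRoofGeo` — ★ RE-HOME of `Lines/F0_P6a_StubFROBRoofGeo.lean` (tree sha16 fb6a2bad2c513567), PART 2 of 2 — tree lines :362–:576 (LAST part: the module the `Lines/` shim and consumers import; it transitively carries parts 1–1).

See PART 1 `Theorems/F0P6aStubFROBRoofGeoHoles.lean` for the full ★ re-home header and the original module docstring (verbatim there).  Same namespace (every fully-qualified name unchanged);
the scopes open at the cut (`noncomputable section` ∕ `namespace` ∕ `section`s) are re-opened below with their `variable` ∕ `open` ∕ `set_option` ∕ `omit` ∕ `include` ∕ `universe` lines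
replayed verbatim from the tree, in order; the code after the replay block is the tree bytes :362–:576, untouched.  HC_CM is proved only modulo the 7 printed citations (2 remaining: hLiu418 = stmt-HodgeConjecture-24832, h413 = stmt-HodgeConjecture-24833) until rung 0 closes; a re-home is count-neutral.
-/

-- ── replay of the scopes open at tree line :362 (verbatim) ──
set_option autoImplicit false
set_option linter.dupNamespace false
set_option linter.unusedSectionVars false
noncomputable section
namespace Summit.HodgeConjecture.HodgeConjecture.Cruxes.HLiu418.F0P6aStubFROBRoofGeo
open CategoryTheory CategoryTheory.Limits NumberField IsDedekindDomain MulAction AlgebraicGeometry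
open scoped Matrix Pointwise MonoidalCategory MonObj CategoryTheory.Obj Polynomial
open Literature.NumberTheory.GaloisRepresentations
open Literature.NumberTheory.Automorphic Literature.NumberTheory.Automorphic.UnitaryGroup
open Literature.AlgebraicGeometry.ShimuraVarieties.UnitaryCanonicalModel
open Literature.NumberTheory.Automorphic.Liu2021.AppendixC
open Literature.AlgebraicGeometry.Motives (AlgPoints IntegralModel SchemeOver thickening thickeningLift specOver relFrobeniusOver frobeniusTwistOver frobSpec)
open Literature.NumberTheory.DiophantineGeometry (geomResidueField specialFibreFunctor specResidueField)
open Literature.AlgebraicGeometry.RelativeSpec (ActionOver)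
open Literature.NumberTheory.EllipticCurves (genericFibre specGenericPoint)
open Literature.AlgebraicGeometry.GroupSchemes Literature.AlgebraicGeometry.GroupSchemes.GroupSchemeKernel
open Literature.AlgebraicGeometry.GroupSchemes.AffineGroupScheme (Alg quotIncl)
open Literature.AlgebraicGeometry.AbelianSchemes Literature.AlgebraicGeometry.AbelianSchemes.AbelianSchemeOver
open Summit.HodgeConjecture.HodgeConjecture.Cruxes.HLiu418.F0P6aModuliDatumDefs
open Summit.HodgeConjecture.HodgeConjecture.Cruxes.HLiu418.F0P6aRGDAssembly
open Summit.HodgeConjecture.HodgeConjecture.Cruxes.HLiu418.F0P6aDatumOfInputs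
open Summit.HodgeConjecture.HodgeConjecture.Cruxes.HLiu418.F0P6aLineSpecialisation (spGeoOf)
open Summit.HodgeConjecture.HodgeConjecture.Cruxes.HLiu418.F0P6aRoofCwKernel (hlaw_cw_of_dockClauses hsat_sch₀Of)
open Summit.HodgeConjecture.HodgeConjecture.Cruxes.HLiu418.F0P6aRoofFrobKernelLawAssembly (natCast_mem_mul_asIdeal_mul_smul_asIdeal)
variable {F : Type} [Field F] [NumberField F] [IsCMField F] [IsGalois ℚ F] {ι₁ : F →+* ℂ}
    {Jstar : Matrix (Fin 2) (Fin 2) F}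
    {K₀ : C5.OpenCompactSubgroup ↥(finAdelic ↥(maximalRealSubfield F) F (IsCMField.complexConj F) 2 Jstar)}
    {S : RecordSystemGS F Jstar ι₁ K₀} {hU7ₛ : S.HeckeTranslateDefinedOver}
    {hJ : (Jstar.map (IsCMField.complexConj F))ᵀ = Jstar} {hJu : IsUnit Jstar}
    {Fi : Type} [Field Fi] [Algebra F Fi] {Kc : C5.SmallLevel K₀} {G : Type} [Group G]
    {𝓜 : IntegralModel (𝓞 F) F ((thickening F Fi).obj (S.M.obj Kc))}
    {w : HeightOneSpectrum (𝓞 F)} {hw : (IsCMField.complexConj F) • w ≠ w} {h𝓨 : (𝓜.localise w).IsSmoothProper 1}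
    {θ : ActionOver (𝓜.localise w).total.hom ((Fi ≃ₐ[F] Fi) × G)}
    {e : Fi →ₐ[F] AlgebraicClosure (w.adicCompletion F)}
-- ── tree bytes :362–:576 ──

/-! ## §F″ — THE `c•w`-BLOCK LAW AT `x̄ = red₀ y` FOR THE LEGS' `q̄` (own budget): §B `hlaw_cw_of_dockClauses` over the holes (C)(D)(F), ★ `hsat_sch₀Of`, `hunr` -/

section CwLaw

variable (I : RGDInputsAt F ι₁ Jstar K₀ S hU7ₛ hJ hJu Fi Kc G 𝓜 w hw h𝓨 θ e) [ExpChar (geomResidueField w) I.pChar]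
  (𝔡 : ∀ xbar, DockAt I xbar) (quotΩ : ∀ y, LineOf I y → AlgPoints (S.M.obj Kc) (AlgebraicClosure (w.adicCompletion F)))
  {m : ℕ} (E' : Matrix (Fin m) (Fin m) (𝓞 F)) (hE' : E' * E' = E') (qbarOf : QbarTy I quotΩ E' hE')

set_option maxHeartbeats 400000 in
/-- **The `c•w`-BLOCK LAW for `q̄_{y,L}`** under the GUARD `spGeoOf I 𝔡 y L = kerFOf …`: W2 §B `hlaw_cw_of_dockClauses` fed by `HoleKer` (`hkerq`), `HoleDock` (`hdock`), `HoleHF` (`hF`),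
★ p850080 `hsat_sch₀Of` (`hsat`) + `hunr`, the (r4₀-q) stability `hqι`, and `𝔠 ⊔ 𝔭_{c•w} = ⊤` — in the `hlaw (v := c•w)` shape of W3 `hL_sch₀Of`.
[cite: Liu2021, Prop. D.8 (3) p. 137] [cite: Tate1997FiniteFlatGroupSchemes, (3.7)] -/
theorem hlaw_cw_of_holes (hole_mono : HoleMono I quotΩ E' hE' qbarOf) (hole_ker : HoleKer I quotΩ E' hE' qbarOf)
    (hole_dock : HoleDock I 𝔡 quotΩ E' hE' qbarOf) (hole_hF : HoleHF I 𝔡) (hunr : ¬ (w.asIdeal ^ 2 ∣ Ideal.span {((I.pChar : ℕ) : 𝓞 F)}))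
    (y : AlgPoints (S.M.obj Kc) (AlgebraicClosure (w.adicCompletion F))) (L : LineOf I y) (hsp : spGeoOf I 𝔡 y L = kerFOf I 𝔡 (red₀Of S Kc 𝓜 w h𝓨 e y))
    (𝔠 : Ideal (𝓞 F)) (h𝔠cop : 𝔠 ⊔ ((IsCMField.complexConj F) • w).asIdeal = ⊤)
    (hqι : haveI := I.comm; ∀ (a : 𝓞 F) ⦃T : SchemeOver (geomResidueField w)⦄ (z : T ⟶ (sch₀Of 𝓜 w I.univ (red₀Of S Kc 𝓜 w h𝓨 e y)).X),
      z ≫ qbarOf y L = 1 → z ≫ (act₀Of 𝓜 w I.univ I.act a (red₀Of S Kc 𝓜 w h𝓨 e y)).hom.hom.hom ≫ qbarOf y L = 1)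
    (n : ℕ) ⦃T : SchemeOver (geomResidueField w)⦄ (x : T ⟶ (sch₀Of 𝓜 w I.univ (red₀Of S Kc 𝓜 w h𝓨 e y)).X)
    (hxN : x ≫ (sch₀Of 𝓜 w I.univ (red₀Of S Kc 𝓜 w h𝓨 e y)).mulN (I.pChar ^ I.fDeg) = 1)
    (hx : ∀ b ∈ ((IsCMField.complexConj F) • w).asIdeal ^ n, x ≫ (act₀Of 𝓜 w I.univ I.act b (red₀Of S Kc 𝓜 w h𝓨 e y)).hom.hom.hom = 1) :
    haveI := I.comm
    (x ≫ relFrobeniusOver I.pChar I.fDeg (sch₀Of 𝓜 w I.univ (red₀Of S Kc 𝓜 w h𝓨 e y)).X =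
        (1 : T ⟶ ((sch₀Of 𝓜 w I.univ (red₀Of S Kc 𝓜 w h𝓨 e y)).baseChange (frobSpec (geomResidueField w) I.pChar I.fDeg)).X)) ↔
      ∀ a ∈ 𝔠, x ≫ (act₀Of 𝓜 w I.univ I.act a (red₀Of S Kc 𝓜 w h𝓨 e y)).hom.hom.hom ≫ qbarOf y L = 1 := by
  haveI := I.comm
  haveI := hole_mono y L
  exact hlaw_cw_of_dockClauses I 𝔡 (red₀Of S Kc 𝓜 w h𝓨 e y) (qbarOf y L) 𝔠 h𝔠cop hqι (hole_ker y L) (hole_dock y L hsp) (hole_hF (red₀Of S Kc 𝓜 w h𝓨 e y))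
    (hsat_sch₀Of I (red₀Of S Kc 𝓜 w h𝓨 e y) (𝔡 (red₀Of S Kc 𝓜 w h𝓨 e y)) hunr) n x hxN hx

end CwLaw

/-! ## §F‴ — THE (rL) LAW AT `x̄ = red₀ y` FOR THE LEGS' `q̄` (own budget): `HoleRL` over `HoleHlawW` (v = w) and §F″ (v = c•w) -/

section RLaw

variable (I : RGDInputsAt F ι₁ Jstar K₀ S hU7ₛ hJ hJu Fi Kc G 𝓜 w hw h𝓨 θ e) [ExpChar (geomResidueField w) I.pChar]
  (𝔡 : ∀ xbar, DockAt I xbar) (quotΩ : ∀ y, LineOf I y → AlgPoints (S.M.obj Kc) (AlgebraicClosure (w.adicCompletion F))) (𝔞 frobIdeal : (Fi ≃ₐ[F] Fi) → Ideal (𝓞 F))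
  {m : ℕ} (E' : Matrix (Fin m) (Fin m) (𝓞 F)) (hE' : E' * E' = E') (qbarOf : QbarTy I quotΩ E' hE')

/-- **The two `p`-adic block laws for `q̄_{y,L}` in W3's `hlaw` binder shape** (`v = w`: `HoleHlawW`; `v = c•w`: §F″ `hlaw_cw_of_holes`).
[cite: Liu2021, Prop. D.8 (3) pp. 136–138] -/
theorem hlaw_of_holes (hole_mono : HoleMono I quotΩ E' hE' qbarOf) (hole_r4q : HoleR4q I quotΩ E' hE' qbarOf) (hole_ker : HoleKer I quotΩ E' hE' qbarOf)
    (hole_dock : HoleDock I 𝔡 quotΩ E' hE' qbarOf) (hole_hF : HoleHF I 𝔡) (hunr : ¬ (w.asIdeal ^ 2 ∣ Ideal.span {((I.pChar : ℕ) : 𝓞 F)}))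
    (hole_hlaw_w : HoleHlawW I 𝔡 quotΩ E' hE' qbarOf 𝔞 frobIdeal)
    (σ : Field.absoluteGaloisGroup (w.adicCompletion F)) (hσ : IsAbsArithFrob σ) (gam : Fi ≃ₐ[F] Fi)
    (hγ : ((AlgEquiv.restrictScalars F (Field.absoluteGaloisGroup.toAlgEquiv (w.adicCompletion F) σ) :
            AlgebraicClosure (w.adicCompletion F) ≃ₐ[F] AlgebraicClosure (w.adicCompletion F)) :
            AlgebraicClosure (w.adicCompletion F) →ₐ[F] AlgebraicClosure (w.adicCompletion F)).comp e = e.comp (gam : Fi →ₐ[F] Fi))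
    (h𝔠 : frobIdeal gam * w.asIdeal = 𝔞 gam) (h𝔠cop : frobIdeal gam ⊔ ((IsCMField.complexConj F) • w).asIdeal = ⊤)
    (y : AlgPoints (S.M.obj Kc) (AlgebraicClosure (w.adicCompletion F))) (L : LineOf I y) (hsp : spGeoOf I 𝔡 y L = kerFOf I 𝔡 (red₀Of S Kc 𝓜 w h𝓨 e y)) :
    haveI := I.comm
    ∀ v : HeightOneSpectrum (𝓞 F), v = w ∨ v = (IsCMField.complexConj F) • w →
      ∀ (n : ℕ) ⦃T : SchemeOver (geomResidueField w)⦄ (x : T ⟶ (sch₀Of 𝓜 w I.univ (red₀Of S Kc 𝓜 w h𝓨 e y)).X),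
      x ≫ (sch₀Of 𝓜 w I.univ (red₀Of S Kc 𝓜 w h𝓨 e y)).mulN (I.pChar ^ I.fDeg) = 1 →
      (∀ b ∈ v.asIdeal ^ n, x ≫ (act₀Of 𝓜 w I.univ I.act b (red₀Of S Kc 𝓜 w h𝓨 e y)).hom.hom.hom = 1) →
      ((x ≫ relFrobeniusOver I.pChar I.fDeg (sch₀Of 𝓜 w I.univ (red₀Of S Kc 𝓜 w h𝓨 e y)).X =
          (1 : T ⟶ ((sch₀Of 𝓜 w I.univ (red₀Of S Kc 𝓜 w h𝓨 e y)).baseChange (frobSpec (geomResidueField w) I.pChar I.fDeg)).X)) ↔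
        ∀ a ∈ frobIdeal gam, x ≫ (act₀Of 𝓜 w I.univ I.act a (red₀Of S Kc 𝓜 w h𝓨 e y)).hom.hom.hom ≫ qbarOf y L = 1) := by
  haveI := I.comm
  -- `hqι` from (r4₀-q): `Ker q̄` is `ι`-stable (`1 ≫ ι_𝒞(a) = 1`, ★ `RingAction.forall_mem_top_iff`); `erw` because the D-line rows and ★ `HoleR4q` spell the
  -- composites with different (defeq) implicit objects (heartbeats 332 290 → 123 763, LA3-p01 (g7) profile 2026-09-03)
  have hqι : ∀ (a : 𝓞 F) ⦃T : SchemeOver (geomResidueField w)⦄ (z : T ⟶ (sch₀Of 𝓜 w I.univ (red₀Of S Kc 𝓜 w h𝓨 e y)).X),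
      z ≫ qbarOf y L = 1 → z ≫ (act₀Of 𝓜 w I.univ I.act a (red₀Of S Kc 𝓜 w h𝓨 e y)).hom.hom.hom ≫ qbarOf y L = 1 := by
    intro a T z hz
    erw [hole_r4q y L a, ← Category.assoc, hz]
    exact ((RingAction.forall_mem_top_iff (((serreAction I.act E' hE').baseChange
      (pullback.fst (𝓜.localise w).total.hom (specResidueField w))).baseChange (red₀Of S Kc 𝓜 w h𝓨 e (quotΩ y L)).left) _).2 rfl) a Submodule.mem_top
  rintro v (rfl | rfl)
  · -- ★ `HoleHlawW` is a `def`: its nested proofs are abstracted (`…._proof_k`), the goal՚s are inline — elaborate the instance FIRST, then close at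
    -- `reducible` transparency so the unifier compares arguments (proof irrelevance) instead of unfolding the group structures (110 k → 1 k)
    have hh := hole_hlaw_w σ hσ _ hγ h𝔠 y L hsp
    with_reducible exact hh
  · exact hlaw_cw_of_holes I 𝔡 quotΩ E' hE' qbarOf hole_mono hole_ker hole_dock hole_hF hunr y L hsp (frobIdeal _) h𝔠cop hqι

/-- **The (rL) FROBENIUS-KERNEL LAW of `Roof₀` for `q̄_{y,L}` and the co-ideal `𝔠 = frobIdeal γ`**, in W3's RAW action currency `act.i a` (seam `hact`): `HoleRL` (W3 `hL_sch₀Of`)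
fed by the banal law `hban = (_hpin …).2`, the arithmetic `h𝔠 hq`, the CRT family (★ p849638), `HoleKer`, and the two `p`-adic block laws — `HoleHlawW` at `v = w`, §F″
`hlaw_cw_of_holes` at `v = c•w` (with `hqι` from `HoleR4q`). [cite: Liu2021, Prop. D.8 (3) p. 135, pp. 136–138] [cite: Shimura1998, §13.1 Thm. 1 (pp. 97–99)] -/
theorem rL_of_holes (hole_mono : HoleMono I quotΩ E' hE' qbarOf) (hole_r4q : HoleR4q I quotΩ E' hE' qbarOf) (hole_ker : HoleKer I quotΩ E' hE' qbarOf)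
    (hole_dock : HoleDock I 𝔡 quotΩ E' hE' qbarOf) (hole_hF : HoleHF I 𝔡) (hunr : ¬ (w.asIdeal ^ 2 ∣ Ideal.span {((I.pChar : ℕ) : 𝓞 F)}))
    (hole_hlaw_w : HoleHlawW I 𝔡 quotΩ E' hE' qbarOf 𝔞 frobIdeal) (hole_rL : HoleRL I)
    (σ : Field.absoluteGaloisGroup (w.adicCompletion F)) (hσ : IsAbsArithFrob σ) (gam : Fi ≃ₐ[F] Fi)
    (hγ : ((AlgEquiv.restrictScalars F (Field.absoluteGaloisGroup.toAlgEquiv (w.adicCompletion F) σ) :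
            AlgebraicClosure (w.adicCompletion F) ≃ₐ[F] AlgebraicClosure (w.adicCompletion F)) :
            AlgebraicClosure (w.adicCompletion F) →ₐ[F] AlgebraicClosure (w.adicCompletion F)).comp e = e.comp (gam : Fi →ₐ[F] Fi))
    (hban : FrobKernelBanal₀ S Kc 𝓜 w h𝓨 e I.univ I.act I.pChar I.fDeg (𝔞 gam)) (h𝔠 : frobIdeal gam * w.asIdeal = 𝔞 gam)
    (hq : ((I.pChar ^ I.fDeg : ℕ) : 𝓞 F) ∈ frobIdeal gam * (w.asIdeal * ((IsCMField.complexConj F) • w).asIdeal))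
    (h𝔠cop : frobIdeal gam ⊔ ((IsCMField.complexConj F) • w).asIdeal = ⊤)
    (y : AlgPoints (S.M.obj Kc) (AlgebraicClosure (w.adicCompletion F))) (L : LineOf I y) (hsp : spGeoOf I 𝔡 y L = kerFOf I 𝔡 (red₀Of S Kc 𝓜 w h𝓨 e y))
    (act : AbelianSchemeOver.RingAction (𝓞 F) (sch₀Of 𝓜 w I.univ (red₀Of S Kc 𝓜 w h𝓨 e y)))
    (hact : ∀ a : 𝓞 F, act.i a = (act₀Of 𝓜 w I.univ I.act a (red₀Of S Kc 𝓜 w h𝓨 e y)).hom.hom.hom)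
    ⦃T : SchemeOver (geomResidueField w)⦄ (t : T ⟶ (sch₀Of 𝓜 w I.univ (red₀Of S Kc 𝓜 w h𝓨 e y)).X) :
    haveI := I.comm
    (t ≫ relFrobeniusOver I.pChar I.fDeg (sch₀Of 𝓜 w I.univ (red₀Of S Kc 𝓜 w h𝓨 e y)).X =
        (1 : T ⟶ ((sch₀Of 𝓜 w I.univ (red₀Of S Kc 𝓜 w h𝓨 e y)).baseChange (frobSpec (geomResidueField w) I.pChar I.fDeg)).X)) ↔
      ∀ a ∈ frobIdeal gam, t ≫ act.i a ≫ qbarOf y L = 1 := by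
  haveI := I.comm
  classical
  haveI : Fact I.pChar.Prime := ⟨I.hpChar.1⟩
  haveI : CharP (geomResidueField w) I.pChar := I.charP₀
  haveI := hole_mono y L
  -- the CRT idempotent family of `(q)` (★ p849638)
  have hq0 : ((I.pChar ^ I.fDeg : ℕ) : 𝓞 F) ≠ 0 := by exact_mod_cast pow_ne_zero _ I.hpChar.1.ne_zero
  obtain ⟨ε, hε1, hε0, -, -, -, -⟩ := Literature.RingTheory.DedekindDomain.exists_crtIdempotentFamily_span_singleton (R := 𝓞 F) hq0
  -- hole (I) is a ★ PART 1 `def`: APPLY it at default transparency (the head unfolds), then close at `reducible` so that its abstracted nested proofs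
  -- (`Hole*._proof_n`) meet this file's inline spellings by argument comparison + proof irrelevance, not by unfolding (272 k → 59 k heartbeats, LA3-p03 (g8))
  have hRL := hole_rL (𝔞 gam) hban y act hact (qbarOf y L) h𝔠 hq ε hε1 hε0 (hole_ker y L)
  with_reducible
    exact hRL (hlaw_of_holes I 𝔡 quotΩ 𝔞 frobIdeal E' hE' qbarOf hole_mono hole_r4q hole_ker hole_dock hole_hF hunr hole_hlaw_w σ hσ gam hγ h𝔠 h𝔠cop y L hsp) t

end RLaw

/-! ## §G — THE W5 JUNCTION: `roofgeo_of_inputs` -/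

section Junction

set_option maxHeartbeats 400000 in
/-- **W5 — THE `stub_ROOFGEO` JUNCTION (leaflet head).**  Binders 1–17 = `stub_ROOFGEO`'s (leaf ED. 3 cand v2 4f35c0d6 :357–:396) TOKEN FOR TOKEN except that
`_hpin` reads `FrobPin₀`'s BODY (`𝔞 ⊔ 𝔭_{c•w} = ⊤ ∧ FrobKernelBanal₀ …`, `rfl`-unfold in the leaf) and the co-ideal is abstract: `(frobIdeal) (hfrob : GUARD → frobIdeal γ · 𝔭_w = 𝔞 γ)`
(leaf: `frobIdeal := frobIdealOf 𝔞 w`, `hfrob := fun σ hσ γ hγ => frobIdealOf_mul_eq 𝔞 w (_hdiv σ hσ γ hγ)`); conclusion `Quot₀RoofLaw I 𝔡 quotΩ (spGeoOf I 𝔡) frobIdeal`.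
JUNCTION INPUTS = the LEGS presentation `(E', P, Q)` of `𝔭_w⁻¹` with scalar `p` (W1's binders), the reduced leg `qbarOf` and the HOLES §E `HoleMono HoleR1 HoleR4q HoleR5q
HoleR3q` (W1), `HoleMiddle` (W1 §2), `HoleKer` (LA1-p04), `HoleDock` (ρ1𝒞 chain), `HoleHF` (W7 §5), `hunr` (spine ED. 5), `HoleHlawW` (W-ε), `HoleRL` (W3 v6) — each landing
deletes one binder (`choose`∕`exact` in the leaf pen's one-liner); W5 = the empty list.  PAID HERE: the ∃-witness `B := sch₀Of 𝓜 w 𝒞 x̄″`, §F `coverLeg_rows` (r2₀, c̄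
surjective, r4₀-c, r5₀-c), the co-ideal arithmetic (`hfrob`, §C `natCast_mem_mul_asIdeal_mul_smul_asIdeal` with `_hspec∕_hnorm∕_hdiv`, `𝔠 ⊔ 𝔭_{c•w} = ⊤` from `(_hpin …).1`),
the CRT family (★ p849638), `hqι` from (B4) (★ `RingAction.forall_mem_top_iff`, no instance search), the `c•w`-block law W2 `hlaw_cw_of_dockClauses` (served) over (D)(F) and W2 §4 ★ `hsat_sch₀Of`
(★ p850080) + `hunr`, and `Roof₀` by §A `roof₀_of_rows'`.  0 `sorry`. [cite: Liu2021, Prop. D.8 (3) p. 135, pp. 136–138] [cite: RapoportSmithlingZhang2020Diagonal, §4.3 (4.23) p. 21]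
[cite: Kottwitz1992, §5 (p. 391)] -/
theorem roofgeo_of_inputs (I : RGDInputsAt F ι₁ Jstar K₀ S hU7ₛ hJ hJu Fi Kc G 𝓜 w hw h𝓨 θ e) [ExpChar (geomResidueField w) I.pChar]
    (𝔡 : ∀ xbar, DockAt I xbar)
    (quotΩ : ∀ y, LineOf I y → AlgPoints (S.M.obj Kc) (AlgebraicClosure (w.adicCompletion F)))
    (translΩ : AlgPoints (S.M.obj Kc) (AlgebraicClosure (w.adicCompletion F)) → AlgPoints (S.M.obj Kc) (AlgebraicClosure (w.adicCompletion F)))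
    (_hhecke : HeckeClause I quotΩ translΩ) (_hroof : RoofLink I quotΩ) (_hroof₂ : RoofLink₂ I translΩ)
    (_hunit : (UnitaryGroup.isUnit_placeForm Jstar hJu w).unit ∈ glInt 2 (w.adicCompletion F))
    (_hKc : UnitaryGroup.IsHyperspecialAt ↥(maximalRealSubfield F) F (IsCMField.complexConj F) 2 Jstar Kc.1.1
      (w.under (𝓞 ↥(maximalRealSubfield F))))
    (_hdisj : haveI : AlgebraicGeometry.IsProper (𝓜.localise w).total.hom := h𝓨.2
      ∀ (β : Fi ≃ₐ[F] Fi) (P Q : AlgPoints (S.M.obj Kc) (AlgebraicClosure (w.adicCompletion F))),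
        (𝓜.localise w).geomReductionMap (thickeningLift e (S.M.obj Kc) P) =
          AlgPoints.map ((specialFibreFunctor w).map (Over.isoMk (θ.aut (β, 1)) (θ.aut_comp (β, 1))).hom :
              (𝓜.localise w).reductionAt ⟶ (𝓜.localise w).reductionAt)
            ((𝓜.localise w).geomReductionMap (thickeningLift e (S.M.obj Kc) Q)) → β = 1)
    (𝔞 : (Fi ≃ₐ[F] Fi) → Ideal (𝓞 F)) (𝔫 : (Fi ≃ₐ[F] Fi) → ℕ)
    (_hdiv : ∀ (σ : Field.absoluteGaloisGroup (w.adicCompletion F)), IsAbsArithFrob σ → ∀ gam : Fi ≃ₐ[F] Fi,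
        ((AlgEquiv.restrictScalars F (Field.absoluteGaloisGroup.toAlgEquiv (w.adicCompletion F) σ) :
            AlgebraicClosure (w.adicCompletion F) ≃ₐ[F] AlgebraicClosure (w.adicCompletion F)) :
            AlgebraicClosure (w.adicCompletion F) →ₐ[F] AlgebraicClosure (w.adicCompletion F)).comp e = e.comp (gam : Fi →ₐ[F] Fi) →
        w.asIdeal ∣ 𝔞 gam)
    (_hnorm : ∀ (σ : Field.absoluteGaloisGroup (w.adicCompletion F)), IsAbsArithFrob σ → ∀ gam : Fi ≃ₐ[F] Fi,
        ((AlgEquiv.restrictScalars F (Field.absoluteGaloisGroup.toAlgEquiv (w.adicCompletion F) σ) :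
            AlgebraicClosure (w.adicCompletion F) ≃ₐ[F] AlgebraicClosure (w.adicCompletion F)) :
            AlgebraicClosure (w.adicCompletion F) →ₐ[F] AlgebraicClosure (w.adicCompletion F)).comp e = e.comp (gam : Fi →ₐ[F] Fi) →
        𝔫 gam = I.pChar ^ I.fDeg)
    (_hcov : ∀ (σ : Field.absoluteGaloisGroup (w.adicCompletion F)), IsAbsArithFrob σ → ∀ gam : Fi ≃ₐ[F] Fi,
        ((AlgEquiv.restrictScalars F (Field.absoluteGaloisGroup.toAlgEquiv (w.adicCompletion F) σ) :
            AlgebraicClosure (w.adicCompletion F) ≃ₐ[F] AlgebraicClosure (w.adicCompletion F)) :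
            AlgebraicClosure (w.adicCompletion F) →ₐ[F] AlgebraicClosure (w.adicCompletion F)).comp e = e.comp (gam : Fi →ₐ[F] Fi) →
        ∀ y : AlgPoints (S.M.obj Kc) (AlgebraicClosure (w.adicCompletion F)),
          FrobCover₀ 𝓜 w I.univ I.act I.dual I.pol I.lvl I.pChar I.fDeg (𝔞 gam) (𝔫 gam)
            (red₀Of S Kc 𝓜 w h𝓨 e (σ • y)) (red₀Of S Kc 𝓜 w h𝓨 e y))
    (_hpin : ∀ (σ : Field.absoluteGaloisGroup (w.adicCompletion F)), IsAbsArithFrob σ → ∀ gam : Fi ≃ₐ[F] Fi,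
        ((AlgEquiv.restrictScalars F (Field.absoluteGaloisGroup.toAlgEquiv (w.adicCompletion F) σ) :
            AlgebraicClosure (w.adicCompletion F) ≃ₐ[F] AlgebraicClosure (w.adicCompletion F)) :
            AlgebraicClosure (w.adicCompletion F) →ₐ[F] AlgebraicClosure (w.adicCompletion F)).comp e = e.comp (gam : Fi →ₐ[F] Fi) →
        𝔞 gam ⊔ (((IsCMField.complexConj F) • w).asIdeal : Ideal (𝓞 F)) = ⊤ ∧
          FrobKernelBanal₀ S Kc 𝓜 w h𝓨 e I.univ I.act I.pChar I.fDeg (𝔞 gam))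
    (_hspec : ∀ gam : Fi ≃ₐ[F] Fi, Ideal.span {((𝔫 gam : ℕ) : 𝓞 F)} = 𝔞 gam * (IsCMField.complexConj F) • 𝔞 gam)
    ---- the co-ideal `𝔠(γ) = 𝔞_γ 𝔭_w⁻¹`, abstract (leaf: `frobIdealOf 𝔞 w`, `frobIdealOf_mul_eq`) ----
    (frobIdeal : (Fi ≃ₐ[F] Fi) → Ideal (𝓞 F))
    (hfrob : ∀ (σ : Field.absoluteGaloisGroup (w.adicCompletion F)), IsAbsArithFrob σ → ∀ gam : Fi ≃ₐ[F] Fi,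
        ((AlgEquiv.restrictScalars F (Field.absoluteGaloisGroup.toAlgEquiv (w.adicCompletion F) σ) :
            AlgebraicClosure (w.adicCompletion F) ≃ₐ[F] AlgebraicClosure (w.adicCompletion F)) :
            AlgebraicClosure (w.adicCompletion F) →ₐ[F] AlgebraicClosure (w.adicCompletion F)).comp e = e.comp (gam : Fi →ₐ[F] Fi) →
        frobIdeal gam * w.asIdeal = 𝔞 gam)
    ---- W5 JUNCTION INPUTS (holes §E, one per supplier) ----
    {m : ℕ} (E' : Matrix (Fin m) (Fin m) (𝓞 F)) (hE' : E' * E' = E') (P : Matrix (Fin m) (Fin 1) (𝓞 F)) (Q : Matrix (Fin 1) (Fin m) (𝓞 F))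
    (hP : E' * P = P) (hQ : Q * E' = Q) (hQP : Q * P = Matrix.scalar (Fin 1) (I.pChar : 𝓞 F))
    (hPQ : P * Q = Matrix.scalar (Fin m) (I.pChar : 𝓞 F) * E') (h𝔭 : Ideal.span (Set.range fun k => P k 0) = w.asIdeal)
    (qbarOf : QbarTy I quotΩ E' hE')
    (hole_mono : HoleMono I quotΩ E' hE' qbarOf) (hole_r1 : HoleR1 I quotΩ E' hE' qbarOf)
    (hole_r4q : HoleR4q I quotΩ E' hE' qbarOf) (hole_r5q : HoleR5q I quotΩ E' hE' P qbarOf) (hole_r3q : HoleR3q I quotΩ E' hE' P qbarOf hole_mono)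
    (hole_middle : HoleMiddle I E' hE' P) (hole_ker : HoleKer I quotΩ E' hE' qbarOf) (hole_dock : HoleDock I 𝔡 quotΩ E' hE' qbarOf)
    (hole_hF : HoleHF I 𝔡) (hunr : ¬ (w.asIdeal ^ 2 ∣ Ideal.span {((I.pChar : ℕ) : 𝓞 F)}))
    (hole_hlaw_w : HoleHlawW I 𝔡 quotΩ E' hE' qbarOf 𝔞 frobIdeal) (hole_rL : HoleRL I) :
    Quot₀RoofLaw I 𝔡 quotΩ (spGeoOf I 𝔡) frobIdeal := by
  haveI := I.comm
  classical
  intro σ hσ gam hγ y L hsp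
  -- characteristic instances at the special point
  haveI : Fact I.pChar.Prime := ⟨I.hpChar.1⟩
  haveI : CharP (geomResidueField w) I.pChar := I.charP₀
  haveI := hole_mono y L
  -- the co-ideal: `𝔠·𝔭_w = 𝔞_γ`, `(q) ∈ 𝔠·𝔭_w·𝔭_{c•w}`, `𝔠 ⊔ 𝔭_{c•w} = ⊤`
  have h𝔠 : frobIdeal gam * w.asIdeal = 𝔞 gam := hfrob σ hσ gam hγ
  have hq : ((I.pChar ^ I.fDeg : ℕ) : 𝓞 F) ∈ frobIdeal gam * (w.asIdeal * ((IsCMField.complexConj F) • w).asIdeal) := by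
    have h := natCast_mem_mul_asIdeal_mul_smul_asIdeal (IsCMField.complexConj F) h𝔠 (_hspec gam) (_hdiv σ hσ gam hγ)
    rwa [_hnorm σ hσ gam hγ] at h
  have h𝔠cop : frobIdeal gam ⊔ ((IsCMField.complexConj F) • w).asIdeal = ⊤ := by
    refine top_le_iff.mp ?_
    rw [← (_hpin σ hσ gam hγ).1, ← h𝔠]
    exact sup_le_sup_right Ideal.mul_le_right _
  -- the middle dual at `x̄″` and the cover leg with its rows (§F)
  obtain ⟨DB, hDB, lamB, hlamB, h3c⟩ := hole_middle (red₀Of S Kc 𝓜 w h𝓨 e (quotΩ y L))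
  haveI := hlamB
  obtain ⟨cbar, hcmon, hcdef, hr2, hsurj, hr4c, hr5c⟩ := coverLeg_rows I E' hE' P Q hP hQ hQP hPQ h𝔭 (red₀Of S Kc 𝓜 w h𝓨 e (quotΩ y L))
  subst hcdef
  -- the (r5₀-q) row, the `hact` seam and the (rL) law need δ (★ `lvlPt₀Of_eq`; `act₀Of … .hom.hom.hom` = `RingAction.i` by `rfl`): read at default transparency
  have hr5 := fun a => (congrArg (AlgPoints.map (qbarOf y L)) (Summit.HodgeConjecture.HodgeConjecture.Cruxes.HLiu418.F0P6aStubFROBRoofMiddleDual.lvlPt₀Of_eq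
    𝓜 w I.univ (red₀Of S Kc 𝓜 w h𝓨 e y) I.lvl a)).trans (hole_r5q y L a)
  have hact : ∀ a : 𝓞 F, ((I.act.baseChange (pullback.fst (𝓜.localise w).total.hom (specResidueField w))).baseChange (red₀Of S Kc 𝓜 w h𝓨 e y).left).i a =
      (act₀Of 𝓜 w I.univ I.act a (red₀Of S Kc 𝓜 w h𝓨 e y)).hom.hom.hom := fun _ => rfl
  have hrl := rL_of_holes I 𝔡 quotΩ 𝔞 frobIdeal E' hE' qbarOf hole_mono hole_r4q hole_ker hole_dock hole_hF hunr hole_hlaw_w hole_rL σ hσ gam hγ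
    ((_hpin σ hσ gam hγ).2) h𝔠 hq h𝔠cop y L hsp _ hact
  -- package `Roof₀` (§F′ `roof₀_of_junction`): fed at default transparency up to the middle-dual row `h3c` (a genuine δ seam); the remaining `def`-typed
  -- rows (abstracted nested proofs `Hole*._proof_n` vs the junction's inline binders) at `reducible` — argument comparison + proof irrelevance (273 k → 130 k)
  have hr4 := hole_r4q y L
  have hJ := roof₀_of_junction I E' hE' P w.asIdeal (frobIdeal gam) (red₀Of S Kc 𝓜 w h𝓨 e y) (red₀Of S Kc 𝓜 w h𝓨 e (quotΩ y L))
    (qbarOf y L) (hole_mono y L) DB hDB lamB hlamB _ hcmon (hole_r1 y L) hr2 hsurj (hole_r3q y L DB hDB lamB h3c) h3c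
  with_reducible exact hJ hr4 hr4c hr5 hr5c _ hact hrl

end Junction

end Summit.HodgeConjecture.HodgeConjecture.Cruxes.HLiu418.F0P6aStubFROBRoofGeo

end
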